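import Literature.MathematicalPhysics.KineticTheory.HardSphereCollisionCampbell
import Literature.Analysis.FluidPDE.HardSphereScattering
import Literature.Analysis.FluidPDE.ControlledHardSphereDynamics
import Literature.Analysis.FluidPDE.BoltzmannEquationProofs
import HarnessLib

/-!
# The outgoing contact flux in incoming midpoint / normal coordinates
# (stub `stub_fluxMidpoint` of line `Sketch`, crux `LambertianContactSwap.ContactAngleEquidistribution`,
# stmt-AtomisticToContinuum-12097)

Support file (`--supports`) for the lead's exact equilibrium centring of the isolated stratum
(skeleton v4 of line `Sketch`). The right-hand side of the tree's stationary collision-rate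
identity `Literature.MathematicalPhysics.KineticTheory.HardSphereCampbellFormula` is the OUTGOING
contact flux `outgoingCollisionFlux ε N g = Σ_{i≠j} ∫ dz ∫ dω ε^{d-1} (⟪ω, vᵢ − vⱼ⟫)₊ 1_D(z^{ij}_ω)
g(z^{ij}_ω, i, j)`, `z^{ij}_ω = contactInsert ε i j ω z` (particle `i` placed at `xⱼ + εω`,
CIP 1994 App. 4.A p. 111, `dσ` on `Σᵢⱼ`); in the line's Campbell identities the mark is read on
the PRE-collisional configuration, `g w i j = H (collidePair i j w)`. For one ordered pair
`(i, j)` this file rewrites that term in INCOMING MIDPOINT coordinates (`stub_fluxMidpoint`):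

`∫ dz ∫ dω ε^{d-1}(⟪ω, vᵢ − vⱼ⟫)₊ 1_D(z^{ij}_ω) H(collidePair i j z^{ij}_ω)
   = ∫ dz ∫ dω ε^{d-1}(⟪ω, vⱼ − vᵢ⟫)₊ (1_D H)(z with xᵢ := xⱼ + (ε/2)ω, xⱼ := xⱼ − (ε/2)ω)`,

by three Liouville-preserving substitutions: (1) VELOCITY REFLECTION (CIP 1994 §4.2, unit
Jacobian of the collision transformation): the inserted pair has separation exactly `εω`
(`sepVec_contactInsert`), so `collidePair` of the contact configuration is the reflection
`collidePairWith i j ω` of `(vᵢ, vⱼ)` across `ω`, which commutes with the insertion, flips the sign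
of `⟪ω, vᵢ − vⱼ⟫` (`inner_reflectVel_fst_sub_snd`) and preserves `volume` on `(T^d × ℝ^d)^N`
(`lintegral_comp_collidePairWith`: Fubini over the coordinates `i, j` by `MeasureTheory.lmarginal`,
positions separated from velocities by Tonelli, and the unit-Jacobian lemma
`Literature.Analysis.FluidPDE.measurePreserving_collideSwap` on `ℝ^d × ℝ^d`); (2) TONELLI in
`(z, ω)` (the substitution depends on `ω`; `volume.toSphere` is finite); (3) the HALF-DIAMETER
SHIFT `xⱼ ↦ xⱼ − (ε/2)ω` of the discarded position (a constant shear along coordinate `j`,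
`Literature.Analysis.FluidPDE.Alexander.lintegral_comp_shearAt`).

References: C. Cercignani, R. Illner, M. Pulvirenti, *The Mathematical Theory of Dilute Gases*,
Springer (1994), §4.2 (the collision transformation preserves Lebesgue measure), App. 4.A
pp. 107–111 (the measure `dσ` on the contact set `Σᵢⱼ`).
-/

noncomputable section

open MeasureTheory Filter Set Topology ProbabilityTheory Function
open scoped ENNReal BigOperators Classical RealInnerProductSpace

namespace Summit.AtomisticToContinuum.HydrodynamicLimit.Theorems.ContactAngleEquidistributionSketch

open Literature.Analysis.FluidPDE Literature.MathematicalPhysics.KineticTheory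

variable {d : Type*} [Fintype d] {N : ℕ}

/-! ### The velocity reflection of a pair preserves the Liouville measure -/

/-- The elastic reflection `reflectVel n` of a velocity pair across any direction `n` preserves
Lebesgue measure on `ℝ^d × ℝ^d` (unit Jacobian of the collision transformation, CIP 1994 §4.2 /
§3.1 p. 35, through `measurePreserving_collideSwap`; the identity at `n = 0`).
[cite: CIP1994, §4.2] -/
theorem measurePreserving_reflectVel (n : EuclideanSpace ℝ d) :
    MeasurePreserving (reflectVel n : EuclideanSpace ℝ d × EuclideanSpace ℝ d → _) volume volume := by
  by_cases hn : n = 0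
  · have h0 : (reflectVel n : EuclideanSpace ℝ d × EuclideanSpace ℝ d → _) = id := by
      funext p
      simp [hn]
    rw [h0]
    exact MeasurePreserving.id volume
  · have h2 : MeasurePreserving (Prod.swap : EuclideanSpace ℝ d × EuclideanSpace ℝ d → _)
        ((volume : Measure (EuclideanSpace ℝ d)).prod volume)
        ((volume : Measure (EuclideanSpace ℝ d)).prod volume) := Measure.measurePreserving_swap
    have h3 := h2.comp (measurePreserving_collideSwap (E := EuclideanSpace ℝ d) (unitDir n hn))
    have hfun : (Prod.swap ∘ fun p : EuclideanSpace ℝ d × EuclideanSpace ℝ d =>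
        (collide (unitDir n hn) p).swap) = reflectVel n := by
      funext p
      simp only [comp_apply, Prod.swap_swap, reflectVel_eq_collide_unitDir n hn]
    rw [hfun] at h3
    exact h3

/-- Tonelli on `(T^d × ℝ^d) × (T^d × ℝ^d)`: the two positions outside, the velocity pair (against
`volume` on `ℝ^d × ℝ^d`) inside. [folklore] -/
theorem lintegral_lintegral_phase_eq
    {K : (UnitAddTorus d × EuclideanSpace ℝ d) × (UnitAddTorus d × EuclideanSpace ℝ d) → ℝ≥0∞}
    (hK : Measurable K) :
    ∫⁻ a, ∫⁻ b, K (a, b) = ∫⁻ p : UnitAddTorus d, ∫⁻ q : UnitAddTorus d,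
      ∫⁻ vw : EuclideanSpace ℝ d × EuclideanSpace ℝ d, K ((p, vw.1), (q, vw.2)) := by
  calc ∫⁻ a, ∫⁻ b, K (a, b)
      = ∫⁻ p : UnitAddTorus d, ∫⁻ v : EuclideanSpace ℝ d, ∫⁻ b, K ((p, v), b) :=
        lintegral_prod (μ := (volume : Measure (UnitAddTorus d)))
          (ν := (volume : Measure (EuclideanSpace ℝ d))) (fun a => ∫⁻ b, K (a, b))
          hK.lintegral_prod_right'.aemeasurable
    _ = ∫⁻ p : UnitAddTorus d, ∫⁻ v : EuclideanSpace ℝ d, ∫⁻ q : UnitAddTorus d,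
          ∫⁻ w : EuclideanSpace ℝ d, K ((p, v), (q, w)) := by
        refine lintegral_congr fun p => lintegral_congr fun v => ?_
        exact lintegral_prod (μ := (volume : Measure (UnitAddTorus d)))
          (ν := (volume : Measure (EuclideanSpace ℝ d))) (fun b => K ((p, v), b))
          (hK.comp measurable_prodMk_left).aemeasurable
    _ = ∫⁻ p : UnitAddTorus d, ∫⁻ q : UnitAddTorus d, ∫⁻ v : EuclideanSpace ℝ d,
          ∫⁻ w : EuclideanSpace ℝ d, K ((p, v), (q, w)) := by
        refine lintegral_congr fun p => ?_
        have hm : Measurable fun t : (EuclideanSpace ℝ d × UnitAddTorus d) × EuclideanSpace ℝ d =>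
            K ((p, t.1.1), (t.1.2, t.2)) := hK.comp (by fun_prop)
        exact lintegral_lintegral_swap hm.lintegral_prod_right'.aemeasurable
    _ = _ := by
        refine lintegral_congr fun p => lintegral_congr fun q => ?_
        have hm : Measurable fun t : EuclideanSpace ℝ d × EuclideanSpace ℝ d =>
            K ((p, t.1), (q, t.2)) := hK.comp (by fun_prop)
        exact lintegral_lintegral hm.aemeasurable

/-- A map of `(T^d × ℝ^d)²` acting on the velocity pair only, by a volume-preserving map of
`ℝ^d × ℝ^d`, does not change iterated integrals over the two phase points. [folklore] -/
theorem lintegral_lintegral_comp_velPair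
    {Θ : EuclideanSpace ℝ d × EuclideanSpace ℝ d → EuclideanSpace ℝ d × EuclideanSpace ℝ d}
    (hΘ : MeasurePreserving Θ volume volume)
    {F : (UnitAddTorus d × EuclideanSpace ℝ d) × (UnitAddTorus d × EuclideanSpace ℝ d) → ℝ≥0∞}
    (hF : Measurable F) :
    ∫⁻ a : UnitAddTorus d × EuclideanSpace ℝ d, ∫⁻ b : UnitAddTorus d × EuclideanSpace ℝ d,
        F ((a.1, (Θ (a.2, b.2)).1), (b.1, (Θ (a.2, b.2)).2)) = ∫⁻ a, ∫⁻ b, F (a, b) := by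
  have hΘm : Measurable Θ := hΘ.measurable
  have hK : Measurable fun ab : (UnitAddTorus d × EuclideanSpace ℝ d) ×
      (UnitAddTorus d × EuclideanSpace ℝ d) =>
      F ((ab.1.1, (Θ (ab.1.2, ab.2.2)).1), (ab.2.1, (Θ (ab.1.2, ab.2.2)).2)) := hF.comp (by fun_prop)
  refine (lintegral_lintegral_phase_eq hK).trans (Eq.trans ?_ (lintegral_lintegral_phase_eq hF).symm)
  refine lintegral_congr fun p => lintegral_congr fun q => ?_
  have hm : Measurable fun u : EuclideanSpace ℝ d × EuclideanSpace ℝ d => F ((p, u.1), (q, u.2)) :=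
    hF.comp (by fun_prop)
  simpa only [Prod.mk.eta] using hΘ.lintegral_comp hm

/-- The controlled collision of the pair `(i, j)` across a fixed normal is measurable on the torus
phase space. [folklore] -/
theorem measurable_collidePairWith_torus (i j : Fin N) (n : EuclideanSpace ℝ d) :
    Measurable (collidePairWith i j n : Config N d (UnitAddTorus d) → Config N d (UnitAddTorus d)) := by
  have hv : Measurable fun z : Config N d (UnitAddTorus d) => ((z i).2, (z j).2) :=
    (measurable_pi_apply i).snd.prodMk (measurable_pi_apply j).snd
  have hr := (measurePreserving_reflectVel n).measurable.comp hv
  have h1 : Measurable fun z : Config N d (UnitAddTorus d) =>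
      ((z i).1, (reflectVel n ((z i).2, (z j).2)).1) := (measurable_pi_apply i).fst.prodMk hr.fst
  have h2 : Measurable fun z : Config N d (UnitAddTorus d) =>
      ((z j).1, (reflectVel n ((z i).2, (z j).2)).2) := (measurable_pi_apply j).fst.prodMk hr.snd
  unfold collidePairWith
  exact measurable_update'.comp ((measurable_update'.comp (measurable_id.prodMk h1)).prodMk h2)

/-- The controlled collision read on the two updated coordinates `i ≠ j`. [folklore] -/
theorem collidePairWith_update_update {i j : Fin N} (hij : i ≠ j) (n : EuclideanSpace ℝ d)
    (x : Config N d (UnitAddTorus d)) (a b : UnitAddTorus d × EuclideanSpace ℝ d) :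
    collidePairWith i j n (update (update x i a) j b) =
      update (update x i (a.1, (reflectVel n (a.2, b.2)).1)) j (b.1, (reflectVel n (a.2, b.2)).2) := by
  funext k
  by_cases hkj : k = j
  · rw [hkj]
    simp only [collidePairWith_apply_right, update_self, update_of_ne hij]
  · by_cases hki : k = i
    · rw [hki]
      simp only [collidePairWith_apply_left hij, update_self, update_of_ne hij]
    · simp only [collidePairWith_apply_of_ne hki hkj, update_of_ne hki, update_of_ne hkj]

/-- **The velocity reflection of a pair preserves the Liouville measure** on `(T^d × ℝ^d)^N`:
`∫ f ∘ collidePairWith i j n = ∫ f` (Fubini over the coordinates `i, j`; on the two phase points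
the map acts on the velocity pair by `reflectVel n`, of unit Jacobian; CIP 1994 §4.2).
[cite: CIP1994, §4.2] -/
theorem lintegral_comp_collidePairWith {i j : Fin N} (hij : i ≠ j) (n : EuclideanSpace ℝ d)
    {f : Config N d (UnitAddTorus d) → ℝ≥0∞} (hf : Measurable f) :
    ∫⁻ z, f (collidePairWith i j n z) = ∫⁻ z, f z := by
  haveI : SigmaFinite (volume : Measure (UnitAddTorus d × EuclideanSpace ℝ d)) := inferInstance
  rw [volume_pi]
  refine lintegral_eq_of_lmarginal_eq {i, j} (hf.comp (measurable_collidePairWith_torus i j n)) hf ?_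
  have hi : i ∉ ({j} : Finset (Fin N)) := by simpa using hij
  funext x
  rw [lmarginal_insert (fun z => f (collidePairWith i j n z))
      (hf.comp (measurable_collidePairWith_torus i j n)) hi,
    lmarginal_insert _ hf hi, lmarginal_singleton, lmarginal_singleton]
  show ∫⁻ a, ∫⁻ b, f (collidePairWith i j n (update (update x i a) j b)) =
    ∫⁻ a, ∫⁻ b, f (update (update x i a) j b)
  simp only [collidePairWith_update_update hij]
  exact lintegral_lintegral_comp_velPair (measurePreserving_reflectVel n)
    (F := fun ab => f (update (update x i ab.1) j ab.2))
    (hf.comp (measurable_update'.comp (((measurable_update x).comp measurable_fst).prodMk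
      measurable_snd)))

/-! ### Contact insertion and the velocity reflection commute -/

/-- Position insertion of `i` at contact with `j` and the reflection of the velocities of
`(i, j)` across a fixed normal commute. [folklore] -/
theorem collidePairWith_contactInsert {i j : Fin N} (hij : i ≠ j) (ε : ℝ)
    (n ω : EuclideanSpace ℝ d) (z : Config N d (UnitAddTorus d)) :
    collidePairWith i j n (contactInsert ε i j ω z) =
      contactInsert ε i j ω (collidePairWith i j n z) := by
  funext k
  by_cases hki : k = i
  · rw [hki, collidePairWith_apply_left hij, contactInsert_apply_self, contactInsert_apply_self,
      contactInsert_apply_of_ne ε j ω z hij.symm, collidePairWith_apply_fst,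
      collidePairWith_apply_left hij]
  · by_cases hkj : k = j
    · rw [hkj, collidePairWith_apply_right, contactInsert_apply_of_ne ε j ω _ hij.symm,
        contactInsert_apply_of_ne ε j ω _ hij.symm, contactInsert_vel, collidePairWith_apply_right]
    · rw [collidePairWith_apply_of_ne hki hkj, contactInsert_apply_of_ne ε j ω _ hki,
        contactInsert_apply_of_ne ε j ω _ hki, collidePairWith_apply_of_ne hki hkj]

/-- At an inserted contact configuration (`0 < ε < 1/2`, `‖ω‖ ≤ 1`) the true collision is the
reflection across `ω` of the velocities of `(i, j)`, applied before the insertion: the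
separation vector of the inserted pair is `εω` (`sepVec_contactInsert`) and only the line `ℝω`
matters. [folklore] -/
theorem collidePair_contactInsert {ε : ℝ} (hε0 : 0 < ε) (hε : ε < 1 / 2) {i j : Fin N}
    (hij : i ≠ j) {ω : EuclideanSpace ℝ d} (hω : ‖ω‖ ≤ 1) (z : Config N d (UnitAddTorus d)) :
    collidePair (Torus.geometry d) i j (contactInsert ε i j ω z) =
      contactInsert ε i j ω (collidePairWith i j ω z) := by
  rw [← collidePairWith_sepVec, sepVec_contactInsert hε0.le hε hij hω, collidePairWith_smul hε0.ne',
    collidePairWith_contactInsert hij]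

/-- The inserted contact configuration lies in the hard-sphere domain iff it does after the
velocities of `(i, j)` are reflected (a velocity reflection does not move the particles). [folklore] -/
theorem contactInsert_collidePairWith_mem_iff {i j : Fin N} (hij : i ≠ j) (ε : ℝ)
    (n ω : EuclideanSpace ℝ d) (z : Config N d (UnitAddTorus d)) :
    contactInsert ε i j ω (collidePairWith i j n z) ∈ hardSphereDomain (Torus.geometry d) N ε ↔
      contactInsert ε i j ω z ∈ hardSphereDomain (Torus.geometry d) N ε := by
  rw [← collidePairWith_contactInsert hij]
  simp only [mem_hardSphereDomain, collidePairWith_apply_fst]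

/-- The reflection across `n ≠ 0` flips the normal relative velocity of the pair:
`⟪n, vⱼ' − vᵢ'⟫ = ⟪n, vᵢ − vⱼ⟫`. [folklore] -/
theorem inner_vel_collidePairWith {i j : Fin N} (hij : i ≠ j) {n : EuclideanSpace ℝ d}
    (hn : n ≠ 0) (z : Config N d (UnitAddTorus d)) :
    ⟪n, (collidePairWith i j n z j).2 - (collidePairWith i j n z i).2⟫ = ⟪n, (z i).2 - (z j).2⟫ := by
  rw [collidePairWith_apply_left hij, collidePairWith_apply_right]
  dsimp only
  rw [← neg_sub, inner_neg_right, inner_reflectVel_fst_sub_snd n hn, neg_neg]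

/-! ### The half-diameter shift -/

omit [Fintype d] in
/-- After shifting `xⱼ` by `−(ε/2)ω` (velocity kept), inserting `i` at contact with `j` in
direction `ω` produces the pair `(xⱼ + (ε/2)ω, xⱼ − (ε/2)ω)`, symmetric about the old `xⱼ`. [folklore] -/
theorem contactInsert_shearAt {ε : ℝ} {i j : Fin N} (hij : i ≠ j)
    (ω : EuclideanSpace ℝ d) (z : Config N d (UnitAddTorus d)) :
    contactInsert ε i j ω (Alexander.shearAt j
        (fun _ => (Literature.Analysis.FunctionSpaces.Torus.proj (-((ε / 2) • ω)),
          (0 : EuclideanSpace ℝ d))) z) =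
      update (update z i ((z j).1 + Literature.Analysis.FunctionSpaces.Torus.proj ((ε / 2) • ω),
        (z i).2)) j
        ((z j).1 + Literature.Analysis.FunctionSpaces.Torus.proj (-((ε / 2) • ω)), (z j).2) := by
  have hsj : Alexander.shearAt j
      (fun _ => (Literature.Analysis.FunctionSpaces.Torus.proj (-((ε / 2) • ω)),
        (0 : EuclideanSpace ℝ d))) z j =
      ((z j).1 + Literature.Analysis.FunctionSpaces.Torus.proj (-((ε / 2) • ω)), (z j).2) := by
    rw [Alexander.shearAt_apply_self]
    exact Prod.ext rfl (add_zero _)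
  have hω : -((ε / 2) • ω) + ε • ω = (ε / 2) • ω := by
    rw [neg_add_eq_sub, ← sub_smul]
    exact congrArg (· • ω) (by ring)
  funext k
  by_cases hki : k = i
  · rw [hki, contactInsert_apply_self, update_of_ne hij, update_self, hsj,
      Alexander.shearAt_apply_of_ne hij]
    dsimp only
    rw [add_assoc, ← Literature.Analysis.FunctionSpaces.Torus.proj_add, hω]
  · by_cases hkj : k = j
    · rw [hkj, contactInsert_apply_of_ne ε j ω _ hij.symm, update_self, hsj]
    · rw [contactInsert_apply_of_ne ε j ω _ hki, update_of_ne hkj, update_of_ne hki,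
        Alexander.shearAt_apply_of_ne hkj]

/-! ### The stub -/

/-- **The outgoing contact flux of a pre-collisional mark in incoming midpoint / normal
coordinates** (stub `stub_fluxMidpoint` of line `Sketch`). For `0 < ε < 1/2`, `i ≠ j` and a
measurable mark `H ≥ 0`,
`∫ dz ∫ dω ε^{d-1}(⟪ω, vᵢ − vⱼ⟫)₊ 1_D(z^{ij}_ω) H(collidePair i j z^{ij}_ω)
  = ∫ dz ∫ dω ε^{d-1}(⟪ω, vⱼ − vᵢ⟫)₊ (1_D H)(z with xᵢ := xⱼ + (ε/2)ω, xⱼ := xⱼ − (ε/2)ω)`: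
swap the `z`- and `ω`-integrals (Tonelli), reflect the velocities of `(i, j)` across `ω` (it
commutes with the insertion, flips the sign of the normal relative velocity and preserves the
Liouville measure), shift the discarded position `xⱼ` by `−(ε/2)ω` (a constant shear), swap back.
[cite: CIP1994, App. 4.A pp. 107–111] -/
theorem stub_fluxMidpoint {d : Type*} [Fintype d] {N : ℕ} {ε : ℝ} (hε0 : 0 < ε) (hε : ε < 1 / 2)
    {i j : Fin N} (hij : i ≠ j) (H : Config N d (UnitAddTorus d) → ℝ≥0∞) (hH : Measurable H) :
    ∫⁻ z : Config N d (UnitAddTorus d), ∫⁻ ω : Metric.sphere (0 : EuclideanSpace ℝ d) 1,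
        ENNReal.ofReal (ε ^ (Fintype.card d - 1) * ⟪((ω : EuclideanSpace ℝ d)), (z i).2 - (z j).2⟫) *
          (hardSphereDomain (Torus.geometry d) N ε).indicator
            (fun w => H (collidePair (Torus.geometry d) i j w))
            (contactInsert ε i j (ω : EuclideanSpace ℝ d) z)
      ∂(volume : Measure (EuclideanSpace ℝ d)).toSphere =
    ∫⁻ z : Config N d (UnitAddTorus d), ∫⁻ ω : Metric.sphere (0 : EuclideanSpace ℝ d) 1,
        ENNReal.ofReal (ε ^ (Fintype.card d - 1) * ⟪((ω : EuclideanSpace ℝ d)), (z j).2 - (z i).2⟫) *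
          (hardSphereDomain (Torus.geometry d) N ε).indicator H
            (Function.update (Function.update z i
                ((z j).1 + Literature.Analysis.FunctionSpaces.Torus.proj ((ε / 2) • (ω : EuclideanSpace ℝ d)),
                  (z i).2)) j
              ((z j).1 + Literature.Analysis.FunctionSpaces.Torus.proj (-((ε / 2) • (ω : EuclideanSpace ℝ d))),
                (z j).2))
      ∂(volume : Measure (EuclideanSpace ℝ d)).toSphere := by
  haveI : SigmaFinite (volume : Measure (UnitAddTorus d × EuclideanSpace ℝ d)) := inferInstance
  haveI : SigmaFinite (volume : Measure (Config N d (UnitAddTorus d))) := inferInstance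
  -- measurability bookkeeping, jointly in `p = (z, ω)`
  have hDm : MeasurableSet (hardSphereDomain (Torus.geometry d) N ε) :=
    measurableSet_hardSphereDomain _ Torus.measurable_geometry_sepVec N ε
  have hωm : Measurable fun p : Config N d (UnitAddTorus d) × Metric.sphere (0 : EuclideanSpace ℝ d) 1 =>
      (p.2 : EuclideanSpace ℝ d) := measurable_subtype_coe.comp measurable_snd
  have hzk : ∀ k : Fin N, Measurable fun p : Config N d (UnitAddTorus d) ×
      Metric.sphere (0 : EuclideanSpace ℝ d) 1 => p.1 k := fun k => (measurable_pi_apply k).comp measurable_fst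
  have hproj := Literature.Analysis.FunctionSpaces.Torus.measurable_proj (d := d)
  have hs1 : Measurable fun p : Config N d (UnitAddTorus d) × Metric.sphere (0 : EuclideanSpace ℝ d) 1 =>
      (ε / 2) • (p.2 : EuclideanSpace ℝ d) := hωm.const_smul (ε / 2)
  have hs3 : Measurable fun p : Config N d (UnitAddTorus d) × Metric.sphere (0 : EuclideanSpace ℝ d) 1 =>
      ε • (p.2 : EuclideanSpace ℝ d) := hωm.const_smul ε
  have hcI : Measurable fun p : Config N d (UnitAddTorus d) × Metric.sphere (0 : EuclideanSpace ℝ d) 1 =>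
      contactInsert ε i j (p.2 : EuclideanSpace ℝ d) p.1 := by
    unfold contactInsert
    exact measurable_update'.comp (measurable_fst.prodMk
      (((hzk j).fst.add (hproj.comp hs3)).prodMk (hzk i).snd))
  have hmid : Measurable fun p : Config N d (UnitAddTorus d) × Metric.sphere (0 : EuclideanSpace ℝ d) 1 =>
      Function.update (Function.update p.1 i
        ((p.1 j).1 + Literature.Analysis.FunctionSpaces.Torus.proj ((ε / 2) • (p.2 : EuclideanSpace ℝ d)),
          (p.1 i).2)) j
        ((p.1 j).1 + Literature.Analysis.FunctionSpaces.Torus.proj (-((ε / 2) • (p.2 : EuclideanSpace ℝ d))),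
          (p.1 j).2) :=
    measurable_update'.comp ((measurable_update'.comp (measurable_fst.prodMk
      (((hzk j).fst.add (hproj.comp hs1)).prodMk (hzk i).snd))).prodMk
      (((hzk j).fst.add (hproj.comp hs1.neg)).prodMk (hzk j).snd))
  have hker : ∀ a b : Fin N, Measurable fun p : Config N d (UnitAddTorus d) ×
      Metric.sphere (0 : EuclideanSpace ℝ d) 1 =>
      ENNReal.ofReal (ε ^ (Fintype.card d - 1) * ⟪((p.2 : EuclideanSpace ℝ d)), (p.1 a).2 - (p.1 b).2⟫) :=
    fun a b => (measurable_const.mul (hωm.inner ((hzk a).snd.sub (hzk b).snd))).ennreal_ofReal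
  have hA : AEMeasurable (uncurry fun (z : Config N d (UnitAddTorus d))
      (ω : Metric.sphere (0 : EuclideanSpace ℝ d) 1) =>
        ENNReal.ofReal (ε ^ (Fintype.card d - 1) * ⟪((ω : EuclideanSpace ℝ d)), (z i).2 - (z j).2⟫) *
          (hardSphereDomain (Torus.geometry d) N ε).indicator
            (fun w => H (collidePair (Torus.geometry d) i j w))
            (contactInsert ε i j (ω : EuclideanSpace ℝ d) z))
      ((volume : Measure (Config N d (UnitAddTorus d))).prod
        (volume : Measure (EuclideanSpace ℝ d)).toSphere) :=
    ((hker i j).mul (((hH.comp (Torus.isMeasurable_geometry.measurable_collidePair i j)).indicator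
      hDm).comp hcI)).aemeasurable
  have hB : AEMeasurable (uncurry fun (z : Config N d (UnitAddTorus d))
      (ω : Metric.sphere (0 : EuclideanSpace ℝ d) 1) =>
        ENNReal.ofReal (ε ^ (Fintype.card d - 1) * ⟪((ω : EuclideanSpace ℝ d)), (z j).2 - (z i).2⟫) *
          (hardSphereDomain (Torus.geometry d) N ε).indicator H
            (Function.update (Function.update z i
                ((z j).1 + Literature.Analysis.FunctionSpaces.Torus.proj ((ε / 2) • (ω : EuclideanSpace ℝ d)),
                  (z i).2)) j
              ((z j).1 + Literature.Analysis.FunctionSpaces.Torus.proj (-((ε / 2) • (ω : EuclideanSpace ℝ d))),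
                (z j).2)))
      ((volume : Measure (Config N d (UnitAddTorus d))).prod
        (volume : Measure (EuclideanSpace ℝ d)).toSphere) :=
    ((hker j i).mul ((hH.indicator hDm).comp hmid)).aemeasurable
  -- the common intermediate integrand `Ψ ω` is measurable for each `ω`
  have hΨ : ∀ ω : Metric.sphere (0 : EuclideanSpace ℝ d) 1, Measurable fun z' : Config N d (UnitAddTorus d) =>
      ENNReal.ofReal (ε ^ (Fintype.card d - 1) * ⟪((ω : EuclideanSpace ℝ d)), (z' j).2 - (z' i).2⟫) *
        (hardSphereDomain (Torus.geometry d) N ε).indicator H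
          (contactInsert ε i j (ω : EuclideanSpace ℝ d) z') := by
    intro ω
    have hc : Measurable fun z' : Config N d (UnitAddTorus d) =>
        contactInsert ε i j (ω : EuclideanSpace ℝ d) z' := hcI.comp (measurable_id.prodMk measurable_const)
    exact (measurable_const.mul (measurable_const.inner ((measurable_pi_apply j).snd.sub
      (measurable_pi_apply i).snd))).ennreal_ofReal.mul ((hH.indicator hDm).comp hc)
  -- (c) Tonelli on both sides
  rw [lintegral_lintegral_swap hA, lintegral_lintegral_swap hB]
  refine lintegral_congr fun ω => ?_
  have hω : ‖(ω : EuclideanSpace ℝ d)‖ = 1 := norm_eq_of_mem_sphere ω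
  have hω0 : (ω : EuclideanSpace ℝ d) ≠ 0 := ne_zero_of_mem_unit_sphere ω
  -- (a) the integrand is `Ψ ω` read after the velocity reflection across `ω`
  have h1 : ∀ z : Config N d (UnitAddTorus d),
      ENNReal.ofReal (ε ^ (Fintype.card d - 1) * ⟪((ω : EuclideanSpace ℝ d)), (z i).2 - (z j).2⟫) *
          (hardSphereDomain (Torus.geometry d) N ε).indicator
            (fun w => H (collidePair (Torus.geometry d) i j w))
            (contactInsert ε i j (ω : EuclideanSpace ℝ d) z) =
        ENNReal.ofReal (ε ^ (Fintype.card d - 1) *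
            ⟪((ω : EuclideanSpace ℝ d)), (collidePairWith i j (ω : EuclideanSpace ℝ d) z j).2 -
              (collidePairWith i j (ω : EuclideanSpace ℝ d) z i).2⟫) *
          (hardSphereDomain (Torus.geometry d) N ε).indicator H
            (contactInsert ε i j (ω : EuclideanSpace ℝ d)
              (collidePairWith i j (ω : EuclideanSpace ℝ d) z)) := by
    intro z
    rw [inner_vel_collidePairWith hij hω0]
    by_cases hmem : contactInsert ε i j (ω : EuclideanSpace ℝ d) z ∈ hardSphereDomain (Torus.geometry d) N ε
    · rw [indicator_of_mem hmem,
        indicator_of_mem ((contactInsert_collidePairWith_mem_iff hij ε _ _ z).2 hmem),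
        collidePair_contactInsert hε0 hε hij hω.le]
    · rw [indicator_of_notMem hmem,
        indicator_of_notMem (mt (contactInsert_collidePairWith_mem_iff hij ε _ _ z).1 hmem)]
  -- (b) reflect (measure preserving), (d) shift `xⱼ` by `−(ε/2)ω` (measure preserving)
  rw [lintegral_congr h1, lintegral_comp_collidePairWith hij _ (hΨ ω),
    ← Alexander.lintegral_comp_shearAt (i := j)
      (φ := fun _ => (Literature.Analysis.FunctionSpaces.Torus.proj (-((ε / 2) • (ω : EuclideanSpace ℝ d))),
        (0 : EuclideanSpace ℝ d))) measurable_const (fun _ _ => rfl) (hΨ ω)]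
  refine lintegral_congr fun z => ?_
  rw [contactInsert_shearAt hij, Alexander.shearAt_apply_of_ne hij, Alexander.shearAt_apply_self,
    Prod.snd_add]
  dsimp only
  rw [add_zero]

end Summit.AtomisticToContinuum.HydrodynamicLimit.Theorems.ContactAngleEquidistributionSketch

end
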